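import Literature.Computability.Complexity.RandomizingPolynomialsCanon
import HarnessLib

/-!
# Randomizing polynomials II′: the Ishai–Kushilevitz canonical form for GENERAL unit-lower-Hessenberg matrices

File II of the series (`RandomizingPolynomialsCanon.lean`) puts the PATH matrix `L(x, ρ)` of an iterated product in
canonical form by explicit eliminators (`pathMat_eq`).  The matrix `L(x)` of a general (affine parity) branching
program is an arbitrary UNIT-LOWER-HESSENBERG matrix over `F₂` — `1` on the subdiagonal, `0` below it, anything on and
above the diagonal [Ishai–Kushilevitz 2002, §3] — and the same canonical form holds for all of them: there are an
upper unitriangular `A` (`IsUnitri`) and a last-column matrix `B` (`IsLastCol`) with `A · L · B = C_{det L}`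
(`exists_canon_of_hessenberg`), equivalently `L = A′ · C_{det L} · B` (`exists_eq_canon_conj`).  This is the linear
algebra behind the perfect degree-3 randomizing polynomials of ARBITRARY mod-2 branching programs
[Applebaum–Ishai–Kushilevitz 2006, §4.2], used by Dvir–Gutfreund–Rothblum–Vadhan (ICS 2011, Thm. 4.5) for general
log-space samplers.

Proof (no induction): `U := [e₀ | columns 0 … d-1 of L]` is upper unitriangular, so `A := U⁻¹` is (`IsUnitri.inv`)
and `A · L = [unit subdiagonal | c]`; the last-column matrix with entries `c (l+1)` clears rows `1 … d` of `c`
(it is an involution), leaving `C_{c 0}`; finally `c 0 = det C_{c 0} = det (A L B) = det L` (`det_canon`,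
`IsUnitri.det_eq_one`).

Then the three properties of the randomization for a general Hessenberg `L` follow exactly as in file II:
`eq_of_proj_hess_eq` (injectivity), `det_eq_of_proj_eq` (decodability), `exists_proj_hess_eq` (range) — the inputs of
the valuation-level perfectness of the degree-3 block of an arbitrary affine parity branching program.

Also here: `IsUnitri.det_eq_one`, `IsUnitri.inv` (inverse of an upper unitriangular matrix is upper unitriangular,
from Mathlib's `Matrix.blockTriangular_inv_of_blockTriangular`), `det_canon`.  Not here: the polynomial / entropy level.

## References

* Y. Ishai, E. Kushilevitz, *Perfect constant-round secure computation via perfect randomizing polynomials*,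
  ICALP 2002, §3 (Lemma on the canonical form of `L(x)`).
* B. Applebaum, Y. Ishai, E. Kushilevitz, *Cryptography in NC⁰*, SIAM J. Comput. 36 (2006), §4.2 (Fact 4.6).
* Z. Dvir, D. Gutfreund, G. N. Rothblum, S. Vadhan, *On approximating the entropy of polynomial mappings*,
  ICS 2011 / ECCC TR10-160, Thm. 4.5.
-/

namespace Literature.Computability.Complexity

namespace RandPoly

open Matrix Finset

variable {d : ℕ}

/-! ### Unitriangular matrices: determinant and inverse -/

/-- An upper unitriangular matrix has determinant `1` (product of the diagonal). [folklore] -/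
theorem IsUnitri.det_eq_one {A : Mat d} (hA : IsUnitri A) : A.det = 1 := by
  rw [Matrix.det_of_upperTriangular (fun i j hij => hA.2 i j hij)]
  exact Finset.prod_eq_one fun i _ => hA.1 i

/-- **The inverse of an upper unitriangular matrix is upper unitriangular** (block-triangularity of the inverse,
plus `(A⁻¹ A)ᵢᵢ = A⁻¹ᵢᵢ · Aᵢᵢ`). [folklore] -/
theorem IsUnitri.inv {A : Mat d} (hA : IsUnitri A) : IsUnitri A⁻¹ := by
  have hdet : IsUnit A.det := by rw [hA.det_eq_one]; exact isUnit_one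
  haveI : Invertible A := Matrix.invertibleOfIsUnitDet A hdet
  have hbt : A.BlockTriangular id := fun i j hij => hA.2 i j hij
  have hinv : A⁻¹.BlockTriangular id := Matrix.blockTriangular_inv_of_blockTriangular hbt
  refine ⟨fun i => ?_, fun i j hij => hinv hij⟩
  have h := congrFun (congrFun (Matrix.nonsing_inv_mul A hdet) i) i
  rw [Matrix.mul_apply, Matrix.one_apply_eq, Finset.sum_eq_single i] at h
  · rwa [hA.1 i, mul_one] at h
  · intro k _ hk
    rcases lt_or_gt_of_ne hk with hlt | hlt
    · rw [hinv hlt, zero_mul]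
    · rw [hA.2 k i hlt, mul_zero]
  · simp

/-! ### The canonical form -/

/-- `det C_δ = δ`: Laplace expansion along row `0`, whose only entry is the corner `δ`; the minor is the identity
(over `F₂` the sign `(-1)^d` is `1`). [cite: IshaiKushilevitz2002, §3] -/
theorem det_canon (δ : ZMod 2) : (canon δ : Mat d).det = δ := by
  rw [Matrix.det_succ_row_zero, Finset.sum_eq_single (Fin.last d)]
  · have hminor : (canon δ : Mat d).submatrix Fin.succ (Fin.last d).succAbove = 1 := by
      ext i k
      rw [Matrix.submatrix_apply, Fin.succAbove_last, canon_apply, Matrix.one_apply]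
      have h1 : ¬ (Fin.succ i = 0 ∧ Fin.castSucc k = Fin.last d) := fun h => Fin.succ_ne_zero i h.1
      rw [if_neg h1, add_zero]
      by_cases hik : i = k
      · subst hik; simp
      · rw [if_neg hik, if_neg]
        intro h; apply hik; exact Fin.ext (by simpa using h)
    rw [hminor, Matrix.det_one, mul_one, canon_apply]
    have hz : ¬ ((0 : Fin (d + 1)).val = (Fin.last d).val + 1) := by simp
    rw [if_neg hz, zero_add, if_pos ⟨rfl, rfl⟩]
    have hneg : ((-1 : ZMod 2) ^ (Fin.last d : ℕ)) = 1 := by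
      have : (-1 : ZMod 2) = 1 := by decide
      rw [this, one_pow]
    rw [hneg, one_mul]
  · intro j _ hj
    rw [canon_apply]
    have hz : ¬ ((0 : Fin (d + 1)).val = j.val + 1) := by simp
    have hc : ¬ ((0 : Fin (d + 1)) = 0 ∧ j = Fin.last d) := fun h => hj h.2
    rw [if_neg hz, if_neg hc, add_zero, mul_zero, zero_mul]
  · simp

/-- **The Ishai–Kushilevitz canonical form of a unit-lower-Hessenberg matrix over `F₂`**: if `L` has `1` on the
subdiagonal and `0` below it, there are an upper unitriangular `A` and a last-column matrix `B` with
`A · L · B = C_{det L}`. [cite: IshaiKushilevitz2002, §3] -/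
theorem exists_canon_of_hessenberg (L : Mat d)
    (hsub : ∀ i j : Fin (d + 1), i.val = j.val + 1 → L i j = 1)
    (hlow : ∀ i j : Fin (d + 1), j.val + 1 < i.val → L i j = 0) :
    ∃ A B : Mat d, IsUnitri A ∧ IsLastCol B ∧ A * L * B = canon L.det := by
  -- `U = [e₀ | columns 0 … d-1 of L]`, upper unitriangular
  obtain ⟨U, hUdef⟩ : ∃ U : Mat d, U = Matrix.of fun j k : Fin (d + 1) =>
      if hk : k.val = 0 then (if j.val = 0 then (1 : ZMod 2) else 0) else L j ⟨k.val - 1, by omega⟩ := ⟨_, rfl⟩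
  have hUsucc : ∀ (j k : Fin (d + 1)) (hk : k.val + 1 < d + 1), U j ⟨k.val + 1, hk⟩ = L j k := by
    intro j k hk
    rw [hUdef, Matrix.of_apply, dif_neg (by simp)]
    congr 1
  have hUtri : IsUnitri U := by
    refine ⟨fun i => ?_, fun i j hji => ?_⟩
    · rw [hUdef, Matrix.of_apply]
      by_cases hi : i.val = 0
      · rw [dif_pos hi, if_pos hi]
      · rw [dif_neg hi]
        exact hsub _ _ (by simp; omega)
    · rw [hUdef, Matrix.of_apply]
      have hji' : j.val < i.val := hji
      by_cases hj : j.val = 0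
      · rw [dif_pos hj, if_neg (by omega)]
      · rw [dif_neg hj]
        exact hlow _ _ (by simp; omega)
  -- the row eliminator `A = U⁻¹`
  have hUdet : IsUnit U.det := by rw [hUtri.det_eq_one]; exact isUnit_one
  obtain ⟨A, hAdef⟩ : ∃ A : Mat d, A = U⁻¹ := ⟨_, rfl⟩
  have hAtri : IsUnitri A := by rw [hAdef]; exact hUtri.inv
  have hAU : A * U = 1 := by rw [hAdef]; exact Matrix.nonsing_inv_mul _ hUdet
  -- columns `0 … d-1` of `A * L` are the unit subdiagonal pattern
  have hcol : ∀ (j k : Fin (d + 1)) (hk : k.val + 1 < d + 1),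
      (A * L) j k = if j.val = k.val + 1 then 1 else 0 := by
    intro j k hk
    have h := congrFun (congrFun hAU j) ⟨k.val + 1, hk⟩
    rw [Matrix.mul_apply, Matrix.one_apply] at h
    have hrw : (∑ x : Fin (d + 1), A j x * U x ⟨k.val + 1, hk⟩) = ∑ x : Fin (d + 1), A j x * L x k :=
      Finset.sum_congr rfl fun x _ => by rw [hUsucc x k hk]
    rw [hrw] at h
    rw [Matrix.mul_apply, h]
    by_cases hjk : j.val = k.val + 1
    · rw [if_pos hjk, if_pos (Fin.ext hjk)]
    · rw [if_neg hjk, if_neg (fun h' => hjk (by rw [h']))]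
  -- the last column of `A * L` and the column eliminator
  obtain ⟨c, hcdef⟩ : ∃ c : Fin (d + 1) → ZMod 2, c = fun j => (A * L) j (Fin.last d) := ⟨_, rfl⟩
  obtain ⟨B, hBdef⟩ : ∃ B : Mat d, B = Matrix.of fun l k : Fin (d + 1) =>
      (if l = k then (1 : ZMod 2) else 0) +
        (if hk : k = Fin.last d ∧ l.val + 1 < d + 1 then c ⟨l.val + 1, hk.2⟩ else 0) := ⟨_, rfl⟩
  have hBapply : ∀ l k : Fin (d + 1), B l k = (if l = k then (1 : ZMod 2) else 0) +
      (if hk : k = Fin.last d ∧ l.val + 1 < d + 1 then c ⟨l.val + 1, hk.2⟩ else 0) := by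
    intro l k; rw [hBdef, Matrix.of_apply]
  have hBlast : IsLastCol B := by
    refine ⟨fun i => ?_, fun i j hij hj => ?_⟩
    · rw [hBapply, if_pos rfl, dif_neg, add_zero]
      rintro ⟨h1, h2⟩
      rw [h1] at h2; simp at h2
    · rw [hBapply, if_neg hij, zero_add, dif_neg (fun h => hj h.1)]
  refine ⟨A, B, hAtri, hBlast, ?_⟩
  -- the product is `canon (c 0)`
  have hprod : A * L * B = canon (c 0) := by
    ext j k
    rw [mul_lastCol_apply hBlast, canon_apply]
    by_cases hk : k = Fin.last d
    · subst hk
      rw [if_pos rfl]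
      have hterm : ∀ l : Fin (d + 1), (A * L) j l * B l (Fin.last d) =
          (if l = Fin.last d then c j else 0) +
            (if hl : l.val + 1 < d + 1 then (if j.val = l.val + 1 then c ⟨l.val + 1, hl⟩ else 0) else 0) := by
        intro l
        rw [hBapply]
        by_cases hl : l = Fin.last d
        · subst hl
          have hno : ¬ ((Fin.last d) = Fin.last d ∧ (Fin.last d).val + 1 < d + 1) := by simp
          have hno' : ¬ ((Fin.last d).val + 1 < d + 1) := by simp
          rw [if_pos rfl, dif_neg hno, if_pos rfl, dif_neg hno', add_zero, mul_one, add_zero]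
          exact (congrFun hcdef j).symm
        · have hl' : l.val + 1 < d + 1 := by
            have := Fin.val_lt_last hl; omega
          rw [if_neg hl, zero_add, dif_pos ⟨rfl, hl'⟩, if_neg hl, zero_add, dif_pos hl', hcol j l hl']
          by_cases hjl : j.val = l.val + 1
          · rw [if_pos hjl, if_pos hjl, one_mul]
          · rw [if_neg hjl, if_neg hjl, zero_mul]
      rw [Finset.sum_congr rfl fun l _ => hterm l, Finset.sum_add_distrib]
      have hs1 : (∑ l : Fin (d + 1), (if l = Fin.last d then c j else 0)) = c j := by
        rw [Finset.sum_ite_eq']; simp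
      rw [hs1]
      have hjlast : ¬ (j.val = (Fin.last d).val + 1) := by have := j.isLt; simp; omega
      rw [if_neg hjlast, zero_add]
      by_cases hj : j = 0
      · subst hj
        rw [if_pos ⟨rfl, rfl⟩]
        have hs2 : (∑ l : Fin (d + 1), (if hl : l.val + 1 < d + 1 then
            (if (0 : Fin (d + 1)).val = l.val + 1 then c ⟨l.val + 1, hl⟩ else 0) else 0)) = 0 := by
          refine Finset.sum_eq_zero fun l _ => ?_
          by_cases h1 : l.val + 1 < d + 1
          · rw [dif_pos h1, if_neg (by simp)]
          · rw [dif_neg h1]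
        rw [hs2, add_zero]
      · rw [if_neg (show ¬ ((j = 0) ∧ Fin.last d = Fin.last d) from fun h => hj h.1)]
        have hjpos : 0 < j.val := Nat.pos_of_ne_zero fun h => hj (Fin.ext h)
        have hs2 : (∑ l : Fin (d + 1), (if hl : l.val + 1 < d + 1 then
            (if j.val = l.val + 1 then c ⟨l.val + 1, hl⟩ else 0) else 0)) = c j := by
          rw [Finset.sum_eq_single ⟨j.val - 1, by omega⟩]
          · have hl : (⟨j.val - 1, by omega⟩ : Fin (d + 1)).val + 1 < d + 1 := by simp; omega
            rw [dif_pos hl, if_pos (by simp; omega)]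
            congr 1
            exact Fin.ext (by simp; omega)
          · intro l _ hl
            by_cases h1 : l.val + 1 < d + 1
            · rw [dif_pos h1, if_neg]
              intro h2; apply hl; exact Fin.ext (by simp; omega)
            · rw [dif_neg h1]
          · simp
        rw [hs2]
        -- `c j + c j = 0` over `F₂`
        have h2 : (2 : ZMod 2) = 0 := by decide
        rw [← two_mul, h2, zero_mul]
    · rw [if_neg hk]
      have hk' : k.val + 1 < d + 1 := by have := Fin.val_lt_last hk; omega
      rw [hcol j k hk', if_neg (show ¬ (j = 0 ∧ k = Fin.last d) from fun h => hk h.2), add_zero]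
  -- identify the corner with the determinant
  have hdet : c 0 = L.det := by
    have h1 : (A * L * B).det = L.det := by
      rw [Matrix.det_mul, Matrix.det_mul, hAtri.det_eq_one, hBlast.isUnitri.det_eq_one,
        one_mul, mul_one]
    rw [hprod, det_canon] at h1
    exact h1
  rw [hprod, hdet]

/-- The same canonical form in the shape of `pathMat_eq`: `L = A · C_{det L} · B` with `A` upper unitriangular and
`B` a last-column matrix (invert `A`, and `B · B = 1`). [cite: ApplebaumIshaiKushilevitz2006, §4.2] -/
theorem exists_eq_canon_conj (L : Mat d)
    (hsub : ∀ i j : Fin (d + 1), i.val = j.val + 1 → L i j = 1)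
    (hlow : ∀ i j : Fin (d + 1), j.val + 1 < i.val → L i j = 0) :
    ∃ A B : Mat d, IsUnitri A ∧ IsLastCol B ∧ L = A * canon L.det * B := by
  obtain ⟨A, B, hA, hB, h⟩ := exists_canon_of_hessenberg L hsub hlow
  have hAdet : IsUnit A.det := by rw [hA.det_eq_one]; exact isUnit_one
  refine ⟨A⁻¹, B, hA.inv, hB, ?_⟩
  rw [← h]
  simp only [Matrix.mul_assoc]
  rw [← Matrix.mul_assoc A⁻¹ A, Matrix.nonsing_inv_mul A hAdet, Matrix.one_mul, hB.mul_self, Matrix.mul_one]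

/-! ### The three properties of the randomization `(A, B) ↦ proj (A · L · B)` for Hessenberg `L` -/

/-- **Injectivity** of `(A, B) ↦ proj (A · L · B)` for a Hessenberg `L` (the general form of `eq_of_proj_pathMat_eq`). [cite: IshaiKushilevitz2002, §3] -/
theorem eq_of_proj_hess_eq {L : Mat d}
    (hs : ∀ i j : Fin (d + 1), i.val = j.val + 1 → L i j = 1)
    (hl : ∀ i j : Fin (d + 1), j.val + 1 < i.val → L i j = 0)
    {A A' B B' : Mat d} (hA : IsUnitri A) (hA' : IsUnitri A') (hB : IsLastCol B) (hB' : IsLastCol B')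
    (h : ∀ i k : Fin (d + 1), i ≤ k → (A * L * B) i k = (A' * L * B') i k) :
    A = A' ∧ B = B' := by
  obtain ⟨A₁, B₁, hA₁, hB₁, hL⟩ := exists_eq_canon_conj L hs hl
  have key : ∀ M N : Mat d, M * L * N = (M * A₁) * canon L.det * (B₁ * N) := fun M N => by
    conv_lhs => rw [hL]
    simp only [Matrix.mul_assoc]
  simp only [key] at h
  obtain ⟨h1, h2, -⟩ := eq_of_proj_canon_eq (hA.mul hA₁) (hA'.mul hA₁) (hB₁.mul hB) (hB₁.mul hB') h
  exact ⟨hA₁.isUnit.mul_right_cancel h1, hB₁.isUnitri.isUnit.mul_left_cancel h2⟩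

/-- **Decodability**: the projection of `A · L · B` determines `det L` (the general form of `pathVal_eq_of_proj_eq`). [cite: IshaiKushilevitz2002, §3] -/
theorem det_eq_of_proj_eq {L L' : Mat d}
    (hs : ∀ i j : Fin (d + 1), i.val = j.val + 1 → L i j = 1)
    (hl : ∀ i j : Fin (d + 1), j.val + 1 < i.val → L i j = 0)
    (hs' : ∀ i j : Fin (d + 1), i.val = j.val + 1 → L' i j = 1)
    (hl' : ∀ i j : Fin (d + 1), j.val + 1 < i.val → L' i j = 0)
    {A A' B B' : Mat d} (hA : IsUnitri A) (hA' : IsUnitri A') (hB : IsLastCol B) (hB' : IsLastCol B')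
    (h : ∀ i k : Fin (d + 1), i ≤ k → (A * L * B) i k = (A' * L' * B') i k) :
    L.det = L'.det := by
  obtain ⟨A₁, B₁, hA₁, hB₁, hL⟩ := exists_eq_canon_conj L hs hl
  obtain ⟨A₂, B₂, hA₂, hB₂, hL'⟩ := exists_eq_canon_conj L' hs' hl'
  have key1 : ∀ M N : Mat d, M * L * N = (M * A₁) * canon L.det * (B₁ * N) := fun M N => by
    conv_lhs => rw [hL]
    simp only [Matrix.mul_assoc]
  have key2 : ∀ M N : Mat d, M * L' * N = (M * A₂) * canon L'.det * (B₂ * N) := fun M N => by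
    conv_lhs => rw [hL']
    simp only [Matrix.mul_assoc]
  have h' : ∀ i k : Fin (d + 1), i ≤ k →
      ((A * A₁) * canon L.det * (B₁ * B) : Mat d) i k = ((A' * A₂) * canon L'.det * (B₂ * B') : Mat d) i k := by
    intro i k hik; rw [← key1, ← key2]; exact h i k hik
  exact (eq_of_proj_canon_eq (hA.mul hA₁) (hA'.mul hA₂) (hB₁.mul hB) (hB₂.mul hB') h').2.2

/-- **Range**: Hessenberg matrices with the same determinant have the same randomizations
(the general form of `exists_proj_pathMat_eq`). [cite: IshaiKushilevitz2002, §3] -/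
theorem exists_proj_hess_eq {L L' : Mat d}
    (hs : ∀ i j : Fin (d + 1), i.val = j.val + 1 → L i j = 1)
    (hl : ∀ i j : Fin (d + 1), j.val + 1 < i.val → L i j = 0)
    (hs' : ∀ i j : Fin (d + 1), i.val = j.val + 1 → L' i j = 1)
    (hl' : ∀ i j : Fin (d + 1), j.val + 1 < i.val → L' i j = 0)
    (hdet : L.det = L'.det) {A B : Mat d} (hA : IsUnitri A) (hB : IsLastCol B) :
    ∃ A' B' : Mat d, IsUnitri A' ∧ IsLastCol B' ∧ A' * L' * B' = A * L * B := by
  obtain ⟨A₁, B₁, hA₁, hB₁, hL⟩ := exists_eq_canon_conj L hs hl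
  obtain ⟨A₂, B₂, hA₂, hB₂, hL'⟩ := exists_eq_canon_conj L' hs' hl'
  have hA₂det : IsUnit A₂.det := by rw [hA₂.det_eq_one]; exact isUnit_one
  refine ⟨A * A₁ * A₂⁻¹, B₂ * B₁ * B, (hA.mul hA₁).mul (hA₂.inv), (hB₂.mul hB₁).mul hB, ?_⟩
  rw [← hdet] at hL'
  conv_lhs => rw [hL']
  conv_rhs => rw [hL]
  simp only [Matrix.mul_assoc]
  rw [← Matrix.mul_assoc A₂⁻¹ A₂, Matrix.nonsing_inv_mul A₂ hA₂det, Matrix.one_mul,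
    ← Matrix.mul_assoc B₂ B₂, hB₂.mul_self, Matrix.one_mul]

end RandPoly

end Literature.Computability.Complexity
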